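import Summits.ResolutionOfSingularities.ResolutionOfSingularities.Theorems.WallFrames9
import Summits.ResolutionOfSingularities.ResolutionOfSingularities.Theorems.NearCutCompanion3
import Summits.ResolutionOfSingularities.ResolutionOfSingularities.Theorems.NearCutWalls2
import Summits.ResolutionOfSingularities.ResolutionOfSingularities.Theorems.ProximityCutArcLaw
import Summits.ResolutionOfSingularities.ResolutionOfSingularities.Theorems.MaxContactCutBoundaryLedger
import Summits.ResolutionOfSingularities.ResolutionOfSingularities.Theorems.MaxContactCutWallCut
import Summits.ResolutionOfSingularities.ResolutionOfSingularities.Theorems.PlanarGhostDescent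
import Literature.AlgebraicGeometry.Resolution.PointBlowupIFPGiraud
import Literature.AlgebraicGeometry.Resolution.AdicNoetherian
import HarnessLib

/-!
# WallFrames (10/17) — Kollár's wall descent in a polynomial frame; sections: Moves (cont.), Axis, TransversalWalk

Verbatim slice of the farm-checked monolith `WallFrames.lean` of cell `decomp-res`, seat `decomp-res-lens-5`, g35
(sha256 7405a21d81d102a4…, monolith lines 2410–2616); one namespace `Summit.ResolutionOfSingularities.ResolutionOfSingularities.Theorems.WallFrames` across the
slices, imports chained.  The monolith's module docstring (laws W1–W7, mechanism, novelty, honest placement) is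
reproduced in slice 1; the main theorem `balancedWallPort_holds : WallCut.BalancedWallPort` (hypothesis-free) and the
host-route corollary `ecBalancedWallPort_holds` (aside item 27368 of route MaxContactCut) are in slice 16/17.
-/

open MvPolynomial Finset
open scoped BigOperators
open Literature.AlgebraicGeometry.Resolution
open Literature.AlgebraicGeometry.Resolution.Hauser2010
open Literature.AlgebraicGeometry.Resolution.PointBlowup
open Literature.AlgebraicGeometry.Resolution.HauserPerlega2024

namespace Summit.ResolutionOfSingularities.ResolutionOfSingularities.Theorems.WallFrames

variable {σ : Type*} [Fintype σ] [DecidableEq σ] {K : Type*} [Field K]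

section Moves

variable {L : Type} [Field L] [DecidableEq L]

/-- `Fin 3` exhaustion by three pairwise distinct indices. [folklore] -/
theorem fin3_cases {j k o : Fin 3} (hkj : k ≠ j) (hoj : o ≠ j) (hok : o ≠ k) (i : Fin 3) :
    i = j ∨ i = k ∨ i = o := by
  rw [Ne, Fin.ext_iff] at hkj hoj hok
  simp only [Fin.ext_iff]
  have := i.isLt; have := j.isLt; have := k.isLt; have := o.isLt
  omega

/-- **MOVE ANATOMY** of a δ-balanced move (both stages balanced): kept wall `k`, third index `o`, centre supported on
`o`, and the dichotomy LOST-WALL (`r_t j = δ`, `r_t o = 0`) / FREE-CHART (`r_t j = 0`, `r_t o = δ`, `b_t o ≠ 0`).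
[new] [folklore] -/
theorem move_anatomy {q : ℕ} {s₀ : State (Fin 3) L} (hroot : TightDefectClasses.IsRoot q s₀)
    (W : TightDefectClasses.ForcedWalk q s₀) (t s : ℕ) (hsh : (W.st t).shade = (s : ℕ∞))
    (hbig : ordZero (W.st t).F ≠ (q : ℕ∞))
    (hbal : (W.st t).r.degree + 2 * s = 2 * q ∧ ∃ x, (W.st t).r x = 0 ∧ ∀ y, y ≠ x → (W.st t).r y + s = q)
    (hbal' : (W.st (t + 1)).r.degree + 2 * s = 2 * q ∧
      ∃ x, (W.st (t + 1)).r x = 0 ∧ ∀ y, y ≠ x → (W.st (t + 1)).r y + s = q) :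
    ∃ k o : Fin 3, k ≠ W.j t ∧ o ≠ W.j t ∧ o ≠ k ∧ (∀ i, i = W.j t ∨ i = k ∨ i = o) ∧
      (W.st t).r k = q - s ∧ W.b t k = 0 ∧ (W.st (t + 1)).r k = q - s ∧ (W.st (t + 1)).r (W.j t) = q - s ∧
      (W.st (t + 1)).r o = 0 ∧ (∀ i, i ≠ o → W.b t i = 0) ∧
      (((W.st t).r (W.j t) = q - s ∧ (W.st t).r o = 0) ∨
       ((W.st t).r (W.j t) = 0 ∧ (W.st t).r o = q - s ∧ W.b t o ≠ 0)) := by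
  classical
  have hsq : s < q := NearCut.lt_of_balanced hroot W t s hsh hbig hbal.1
  obtain ⟨hj, k, hkj, hrk, hbk, hrk', hzero⟩ := NearCut.walls_succ hroot W t s hsh hbig hbal.1 hbal'
  obtain ⟨o, hoj, hok⟩ := NearCut.fin3_third (W.j t) k
  have hcases := fin3_cases hkj hoj hok
  have hro' : (W.st (t + 1)).r o = 0 := hzero o hoj hok
  have hbj : W.b t (W.j t) = 0 := W.onExc t
  have hr'o : (W.st (t + 1)).r o = if W.b t o = 0 then (W.st t).r o else 0 := by
    rw [NearCut.st_succ_r, Finsupp.coe_update, Function.update_of_ne hoj, Finsupp.filter_apply]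
  obtain ⟨x, hx0, hx⟩ := hbal.2
  have hxk : x ≠ k := fun h => by rw [h] at hx0; omega
  refine ⟨k, o, hkj, hoj, hok, hcases, hrk, hbk, hrk', hj, hro', ?_, ?_⟩
  · intro i hi
    rcases hcases i with h | h | h
    · rw [h]; exact hbj
    · rw [h]; exact hbk
    · exact absurd h hi
  · by_cases hxj : x = W.j t
    · right
      have hoj' : o ≠ x := by rw [hxj]; exact hoj
      have hro : (W.st t).r o = q - s := by have := hx o hoj'; omega
      refine ⟨by rw [← hxj]; exact hx0, hro, fun hbo => ?_⟩
      rw [hr'o, if_pos hbo, hro] at hro'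
      omega
    · left
      have hrj : (W.st t).r (W.j t) = q - s := by have := hx (W.j t) (Ne.symm hxj); omega
      have hxo : x = o := by
        rcases hcases x with h | h | h
        · exact absurd h hxj
        · exact absurd h hxk
        · exact h
      exact ⟨hrj, by rw [← hxo]; exact hx0⟩

/-- **THE LETTER SWITCH.**  Two consecutive δ-balanced moves `t`, `t+1` (walls of stage `t+1` = `{j_t, k}`, third index
`o` with `r_{t+1} o = 0`; anatomy `(k', o')` of move `t+1` as in `move_anatomy`) with `StaysOnNewest W t` (the chart
changes and the next centre lies on the newest wall `E_t = {y_{j_t} = 0}`): then move `t+1` KEEPS `j_t` (`k' = j_t`) and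
LOSES the wall `k` kept at move `t` — as the chart in a lost-wall move (`j_{t+1} = k`) or as the translated wall in a
free-chart move (`o' = k`).  With the slot of `E` inherited from the lost wall this is the alternation `w(t+1) ≠ w(t)` of
the toric word (NEXT-g36 §1). [new] [folklore] -/
theorem lost_of_staysOnNewest {q : ℕ} {s₀ : State (Fin 3) L} (W : TightDefectClasses.ForcedWalk q s₀) (t : ℕ)
    {δ : ℕ} (hδ : δ ≠ 0) {k o k' o' : Fin 3} (hkj : k ≠ W.j t) (hcases : ∀ i, i = W.j t ∨ i = k ∨ i = o)
    (hrE : (W.st (t + 1)).r (W.j t) = δ) (hro : (W.st (t + 1)).r o = 0)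
    (ho'k' : o' ≠ k') (hcases' : ∀ i, i = W.j (t + 1) ∨ i = k' ∨ i = o') (hrk' : (W.st (t + 1)).r k' = δ)
    (hdich : ((W.st (t + 1)).r (W.j (t + 1)) = δ ∧ (W.st (t + 1)).r o' = 0) ∨
      ((W.st (t + 1)).r (W.j (t + 1)) = 0 ∧ (W.st (t + 1)).r o' = δ ∧ W.b (t + 1) o' ≠ 0))
    (hstay : ProximityCut.StaysOnNewest W t) :
    k' = W.j t ∧ (((W.st (t + 1)).r (W.j (t + 1)) = δ ∧ W.j (t + 1) = k) ∨
      ((W.st (t + 1)).r (W.j (t + 1)) = 0 ∧ o' = k)) := by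
  obtain ⟨hjj, hbE⟩ := hstay
  have wall_cases : ∀ i, (W.st (t + 1)).r i = δ → i = W.j t ∨ i = k := fun i hi => by
    rcases hcases i with h | h | h
    · exact Or.inl h
    · exact Or.inr h
    · exfalso; rw [h, hro] at hi; exact hδ hi.symm
  have hk'E : k' = W.j t := by
    rcases wall_cases k' hrk' with h | h
    · exact h
    · exfalso
      have hjo' : W.j t = o' := by
        rcases hcases' (W.j t) with h1 | h1 | h1
        · exact absurd h1.symm hjj
        · exact absurd (h1.trans h) hkj.symm
        · exact h1
      rcases hdich with ⟨-, ho'0⟩ | ⟨-, -, hbo'⟩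
      · rw [← hjo', hrE] at ho'0; exact hδ ho'0
      · rw [← hjo'] at hbo'; exact hbo' hbE
  refine ⟨hk'E, ?_⟩
  rcases hdich with ⟨hjw, -⟩ | ⟨hj0, ho'δ, -⟩
  · left
    refine ⟨hjw, ?_⟩
    rcases wall_cases _ hjw with h | h
    · exact absurd h hjj
    · exact h
  · right
    refine ⟨hj0, ?_⟩
    rcases wall_cases _ ho'δ with h | h
    · exact absurd (h.trans hk'E.symm) ho'k'
    · exact h

end Moves

/-! ## §16 TRANSVERSALITY of the directrix to the free letter along a δ-balanced recurrent tail (NEXT-g36 §2, PROVED)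

AXIS LEMMA (generic): if at a near move the directrix `ℓ` has zero coefficient on the free letter, nearness of the
centre forces `ℓ = α·y_k` for the KEPT wall `k`.  WALK THEOREM: along the companion chain of a δ-balanced tail with
`StaysOnNewest` recurring, the directrix is transverse to the free letter at EVERY stage — otherwise the axis directrix
`y_k^s` propagates forever (`translate_chartTransform_sub_mem_span`, `transversal_of_congr`), the wall `k` is kept at every
later move, and `StaysOnNewest` (which forces the next move to lose the kept wall, `lost_of_staysOnNewest`) never happens. -/

section Axis

/-- **AXIS LEMMA.**  Near move in chart `j` with kept wall `k` (`b_k = 0`), third index `o`; `in_s G = c·ℓ^s`, `G'(0) = 0`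
for `G' = translate b (cT_s^j G)`; if the free coefficient of `ℓ` vanishes (lost-wall: `coeff_{y_o} ℓ = 0`; free-chart:
`coeff_{y_j} ℓ = 0` with `b_o ≠ 0`) then `ℓ = α·y_k`, `α ≠ 0`. [new] [folklore] -/
theorem axis_of_coeff_eq_zero {j k o : σ} (hkj : k ≠ j) (hoj : o ≠ j) (hσ3 : ∀ i, i = j ∨ i = k ∨ i = o)
    {b : σ → K} (hbj : b j = 0) (hbk : b k = 0) {s : ℕ} (hs : s ≠ 0) {c : K} (hc : c ≠ 0)
    {ℓ G G' : MvPolynomial σ K} (hℓ : ℓ.IsHomogeneous 1) (hℓ0 : ℓ ≠ 0) (hG : (s : ℕ∞) ≤ ordZero G)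
    (hin : homogeneousComponent s G = C c * ℓ ^ s) (hG' : G' = PointBlowup.translate b (chartTransform s j G))
    (hG'0 : constantCoeff G' = 0)
    (hfree : coeff (Finsupp.single o 1) ℓ = 0 ∨ (coeff (Finsupp.single j 1) ℓ = 0 ∧ b o ≠ 0)) :
    (∀ i, i ≠ k → coeff (Finsupp.single i 1) ℓ = 0) ∧ coeff (Finsupp.single k 1) ℓ ≠ 0 := by
  classical
  have hnear : ∑ i, coeff (Finsupp.single i 1) ℓ * Function.update b j 1 i = 0 := by
    have h := constantCoeff_translate_chartTransform j hbj hG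
    rw [← hG', hG'0, hin, map_mul, eval_C, map_pow, eval_of_isHomogeneous_one hℓ] at h
    exact (pow_eq_zero_iff hs).mp ((mul_eq_zero.mp h.symm).resolve_left hc)
  have hjo : coeff (Finsupp.single j 1) ℓ = 0 ∧ coeff (Finsupp.single o 1) ℓ = 0 := by
    rcases hfree with hαo | ⟨hαj, hbo⟩
    · have hsum : ∑ i, coeff (Finsupp.single i 1) ℓ * Function.update b j 1 i = coeff (Finsupp.single j 1) ℓ := by
        rw [Finset.sum_eq_single j]
        · rw [Function.update_self, mul_one]
        · intro i _ hij
          rcases hσ3 i with h | h | h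
          · exact absurd h hij
          · rw [h, Function.update_of_ne hkj, hbk, mul_zero]
          · rw [h, hαo, zero_mul]
        · intro h; exact absurd (Finset.mem_univ j) h
      exact ⟨by rw [← hsum]; exact hnear, hαo⟩
    · have hsum : ∑ i, coeff (Finsupp.single i 1) ℓ * Function.update b j 1 i =
          coeff (Finsupp.single o 1) ℓ * b o := by
        rw [Finset.sum_eq_single o]
        · rw [Function.update_of_ne hoj]
        · intro i _ hio
          rcases hσ3 i with h | h | h
          · rw [h, hαj, zero_mul]
          · rw [h, Function.update_of_ne hkj, hbk, mul_zero]
          · exact absurd h hio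
        · intro h; exact absurd (Finset.mem_univ o) h
      refine ⟨hαj, ?_⟩
      rw [hsum] at hnear
      exact (mul_eq_zero.mp hnear).resolve_right hbo
  refine ⟨fun i hik => ?_, fun hαk => hℓ0 ?_⟩
  · rcases hσ3 i with h | h | h
    · rw [h]; exact hjo.1
    · exact absurd h hik
    · rw [h]; exact hjo.2
  · rw [eq_sum_of_isHomogeneous_one hℓ]
    refine Finset.sum_eq_zero fun i _ => ?_
    rcases hσ3 i with h | h | h
    · rw [h, hjo.1, C_0, zero_mul]
    · rw [h, hαk, C_0, zero_mul]
    · rw [h, hjo.2, C_0, zero_mul]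

omit [Fintype σ] in
/-- A linear form supported on one letter: `ℓ = α·y_k`. [folklore] -/
theorem eq_C_mul_X_of_coeff [Fintype σ] {ℓ : MvPolynomial σ K} (hℓ : ℓ.IsHomogeneous 1) {k : σ}
    (hzero : ∀ i, i ≠ k → coeff (Finsupp.single i 1) ℓ = 0) :
    ℓ = C (coeff (Finsupp.single k 1) ℓ) * X k := by
  classical
  conv_lhs => rw [eq_sum_of_isHomogeneous_one hℓ]
  rw [Finset.sum_eq_single k]
  · intro i _ hik; rw [hzero i hik, C_0, zero_mul]
  · intro h; exact absurd (Finset.mem_univ k) h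

/-- **NEARNESS EQUATION.** At a near move (`G'(0) = 0`, `G' = translate b (cT_s^j G)`, `in_s G = c ℓ^s`):
`Σ_i coeff_{y_i} ℓ · b̂_i = 0` with `b̂ = b[j ↦ 1]` — the centre lies on the projectivised directrix. [new] [folklore] -/
theorem nearness_sum (j : σ) {b : σ → K} (hbj : b j = 0) {s : ℕ} (hs : s ≠ 0) {c : K} (hc : c ≠ 0)
    {ℓ G : MvPolynomial σ K} (hℓ : ℓ.IsHomogeneous 1) (hG : (s : ℕ∞) ≤ ordZero G)
    (hin : homogeneousComponent s G = C c * ℓ ^ s)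
    (hG'0 : constantCoeff (PointBlowup.translate b (chartTransform s j G)) = 0) :
    ∑ i, coeff (Finsupp.single i 1) ℓ * Function.update b j 1 i = 0 := by
  have h := constantCoeff_translate_chartTransform j hbj hG
  rw [hG'0, hin, map_mul, eval_C, map_pow, eval_of_isHomogeneous_one hℓ] at h
  exact (pow_eq_zero_iff hs).mp ((mul_eq_zero.mp h.symm).resolve_left hc)

omit [DecidableEq σ] in
/-- Sums over a three-letter index type. [folklore] -/
theorem sum_eq_of_three {j k o : σ} (hkj : k ≠ j) (hoj : o ≠ j) (hok : o ≠ k) (hσ3 : ∀ i, i = j ∨ i = k ∨ i = o)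
    (g : σ → K) : ∑ i, g i = g j + g k + g o := by
  classical
  have huniv : (Finset.univ : Finset σ) = {j, k, o} := by
    ext i
    simp only [Finset.mem_univ, Finset.mem_insert, Finset.mem_singleton, true_iff]
    exact hσ3 i
  have h1 : j ∉ ({k, o} : Finset σ) := by
    simp only [Finset.mem_insert, Finset.mem_singleton, not_or]; exact ⟨hkj.symm, hoj.symm⟩
  have h2 : k ∉ ({o} : Finset σ) := by
    simp only [Finset.mem_singleton]; exact hok.symm
  rw [huniv, Finset.sum_insert h1, Finset.sum_insert h2, Finset.sum_singleton, add_assoc]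

end Axis

section TransversalWalk

variable {L : Type} [Field L] [DecidableEq L]

end TransversalWalk

end Summit.ResolutionOfSingularities.ResolutionOfSingularities.Theorems.WallFrames
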